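import Summits.BirchSwinnertonDyer.BirchSwinnertonDyer.Theorems.ManinLocalTwoThreeEtaIdentityReductionThirtySix
import Summits.BirchSwinnertonDyer.BirchSwinnertonDyer.Theorems.ManinLocalTwoThreeLigozatIdentitiesTwentySeven
import HarnessLib

/-!
# The `η`-identities at level 36 and `|c| = 1` on `X₀(36)` — unconditionally

Cell bsd-f2-manin, route `ManinLocalTwoThree` (C2 `ManinOddAtFour` stmt-22967: `4 ∣ 36`; C3
`ManinPrimeToThreeAtNine` stmt-22968: `9 ∣ 36`), prover seat p2 gen 26; last file of the level-`36` run of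
the hexagonal-squeeze architecture (p3 g22/g23 at `N = 27`, -an g49 at `N = 32`).  We discharge the three
`q`-asymptotics (T1) `((2πi)⁻¹x′ + φ₃₆·2Y)/q → 0`, (T2) `((2πi)⁻¹Y′ + φ₃₆·3x²)/q → 0`, (T3) `x³ + 1 − Y² → 0`
at `i∞` of `EtaIdentityReductionThirtySix.abs_maninConstant_eq_one_thirtySix_of_tendsto`, for
`x = η(12τ)η(18τ)³/(η(6τ)η(36τ)³) = E₁₂E₁₈³/(q²E₆E₃₆³)`, `Y = η(12τ)⁴η(18τ)²/(η(6τ)²η(36τ)⁴) = E₁₂⁴E₁₈²/(q³E₆²E₃₆⁴)`,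
`φ₃₆ = η(6τ)⁴ = qE₆⁴` (`E_δ = ∏(1 − q^{δn})`).  METHOD (p3's remainder calculus `QRemainder`,
`EulerRemainders`): by the logarithmic derivatives each target is `G/(q^k · unit)` with `G` a polynomial in
`q, E_δ, E_δ′`, and modulo `o(q^k)`: `E_δ ≡ 1`, `E_δ′ ≡ 0` (`k = 3, 4 < 6`) resp. `E₆ ≡ 1 − q⁶`,
`E₁₂ ≡ E₁₈ ≡ E₃₆ ≡ 1` (`k = 6`); the truncation of `G` vanishes identically (`ring`) — at level `36` everything
lives in `q^ℤ·ℂ⟦q⁶⟧`, so the windows are tiny.  CONSEQUENCES (§4): `x′ = −2πiφ₃₆·2Y`, `Y′ = −2πiφ₃₆·3x²`,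
`Y² = x³ + 1` on `ℍ` (the `η`-quotients parametrise `36a1 : y² = x³ + 1`); (S2)₃₆ `Λ(φ₃₆) ⊆ Λ(0, −4)`; and
**`|D.maninConstant| = 1` for every globally minimal `W/ℚ` and every `X₀(36)`-parametrisation datum `D` of
`W` with the lattice clause** — no modularity, CDT or printed Manin-constant hypothesis; hence `2 ∤ c` and
`3 ∤ c`: the cruxes C2 and C3 AT THE LEVEL `N = 36 = 4·9` — the first level in BOTH crux domains — hold
there with none of their fact hypotheses.  BSD is not proved by this; Manin's conjecture is not proved by
this; C2/C3 stay OPEN as filed.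
[cite: Ligozat1975, Ch. 4] [cite: Koehler2011, §1] [cite: CremonaAlgorithms1997, Table 1 (36a1), §2.10]
-/

set_option autoImplicit false
-- lint-debt: the directory name repeats the summit name (sibling precedent `ManinLocalTwoThreeLigozatIdentitiesTwentySeven.lean`)
set_option linter.dupNamespace false

noncomputable section

open Complex Filter Topology Set Asymptotics Polynomial
open UpperHalfPlane hiding I
open scoped Real Topology Manifold MatrixGroups
open Literature.NumberTheory.EllipticCurves Literature.NumberTheory.EllipticCurves.ModularForms

namespace Summit.BirchSwinnertonDyer.BirchSwinnertonDyer.Theorems.ManinLocalTwoThree.LigozatIdentitiesThirtySix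

open QRemainder EulerRemainders LigozatIdentities

/-! ## §1 `E₆ = 1 − q⁶ + o(q⁶)`; `x, Y, φ₃₆` in terms of `q` and the Euler functions -/

/-- The first seven `q`-coefficients of `E₆ = ∏(1 − q⁶ⁿ)`: `1, 0, 0, 0, 0, 0, −1`. [folklore] -/
theorem coeff_formalEulerScaled_six (n : ℕ) (hn : n ≤ 6) :
    PowerSeries.coeff n (formalEulerScaled 6) = if n = 0 then 1 else if n = 6 then -1 else 0 := by
  obtain ⟨h0, h1, -⟩ := coeff_formalEulerPow_one_of_le_two
  interval_cases n <;> simp +decide [coeff_formalEulerScaled, h0, h1]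

/-- **`E₆ = 1 − q⁶ + o(q⁶)`.** [folklore] -/
theorem tendsto_eulerFn_six :
    Tendsto (fun τ : ℍ ↦ (eulerFn 6 τ - (1 - X ^ 6 : ℂ[X]).eval (Function.Periodic.qParam 1 (τ : ℂ)))
      / Function.Periodic.qParam 1 (τ : ℂ) ^ 6) atImInfty (𝓝 0) := by
  refine congr_poly ?_ (tendsto_of_hasSum (periodic_eulerFn 6) (mdifferentiable_eulerFn 6)
    (isBoundedAtImInfty_eulerFn (by norm_num)) (hasSum_eulerFn (by norm_num)) 6)
  have h := coeff_formalEulerScaled_six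
  simp only [Finset.sum_range_succ, Finset.sum_range_zero, h 0 (by norm_num), h 1 (by norm_num),
    h 2 (by norm_num), h 3 (by norm_num), h 4 (by norm_num), h 5 (by norm_num), h 6 (by norm_num)]
  norm_num
  ring

/-- **`x = η(12τ)η(18τ)³/(η(6τ)η(36τ)³) = E₁₂E₁₈³/(q²E₆E₃₆³)`.** [folklore] -/
theorem x36_eq (τ : ℍ) :
    etaQuotient 36 (expFn [(6, -1), (12, 1), (18, 3), (36, -3)]) τ
      = eulerFn 12 τ * eulerFn 18 τ ^ 3
        / (Function.Periodic.qParam 1 (τ : ℂ) ^ 2 * eulerFn 6 τ * eulerFn 36 τ ^ 3) := by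
  have hE6 := eulerFn_ne_zero (by norm_num : 0 < 6) τ
  have hE36 := eulerFn_ne_zero (by norm_num : 0 < 36) τ
  have hq := qParam_ne_zero τ
  rw [etaQuotient_eq_cexp_mul_prod, show Nat.divisors 36 = {1, 2, 3, 4, 6, 9, 12, 18, 36} by decide]
  have hsum : (∑ δ ∈ ({1, 2, 3, 4, 6, 9, 12, 18, 36} : Finset ℕ),
      (δ : ℤ) * expFn [(6, -1), (12, 1), (18, 3), (36, -3)] δ) = (-(24 * 2 : ℕ) : ℤ) := by decide
  rw [hsum, cexp_neg_eq_inv_qParam_pow]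
  rw [Finset.prod_insert (by decide), Finset.prod_insert (by decide), Finset.prod_insert (by decide),
    Finset.prod_insert (by decide), Finset.prod_insert (by decide), Finset.prod_insert (by decide),
    Finset.prod_insert (by decide), Finset.prod_insert (by decide), Finset.prod_singleton]
  rw [show expFn [(6, -1), (12, 1), (18, 3), (36, -3)] 1 = 0 by decide,
    show expFn [(6, -1), (12, 1), (18, 3), (36, -3)] 2 = 0 by decide,
    show expFn [(6, -1), (12, 1), (18, 3), (36, -3)] 3 = 0 by decide,
    show expFn [(6, -1), (12, 1), (18, 3), (36, -3)] 4 = 0 by decide,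
    show expFn [(6, -1), (12, 1), (18, 3), (36, -3)] 6 = -1 by decide,
    show expFn [(6, -1), (12, 1), (18, 3), (36, -3)] 9 = 0 by decide,
    show expFn [(6, -1), (12, 1), (18, 3), (36, -3)] 12 = 1 by decide,
    show expFn [(6, -1), (12, 1), (18, 3), (36, -3)] 18 = 3 by decide,
    show expFn [(6, -1), (12, 1), (18, 3), (36, -3)] 36 = -3 by decide]
  simp only [zpow_neg, zpow_ofNat]
  field_simp

/-- **`Y = η(12τ)⁴η(18τ)²/(η(6τ)²η(36τ)⁴) = E₁₂⁴E₁₈²/(q³E₆²E₃₆⁴)`.** [folklore] -/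
theorem Y36_eq (τ : ℍ) :
    etaQuotient 36 (expFn [(6, -2), (12, 4), (18, 2), (36, -4)]) τ
      = eulerFn 12 τ ^ 4 * eulerFn 18 τ ^ 2
        / (Function.Periodic.qParam 1 (τ : ℂ) ^ 3 * eulerFn 6 τ ^ 2 * eulerFn 36 τ ^ 4) := by
  have hE6 := eulerFn_ne_zero (by norm_num : 0 < 6) τ
  have hE36 := eulerFn_ne_zero (by norm_num : 0 < 36) τ
  have hq := qParam_ne_zero τ
  rw [etaQuotient_eq_cexp_mul_prod, show Nat.divisors 36 = {1, 2, 3, 4, 6, 9, 12, 18, 36} by decide]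
  have hsum : (∑ δ ∈ ({1, 2, 3, 4, 6, 9, 12, 18, 36} : Finset ℕ),
      (δ : ℤ) * expFn [(6, -2), (12, 4), (18, 2), (36, -4)] δ) = (-(24 * 3 : ℕ) : ℤ) := by decide
  rw [hsum, cexp_neg_eq_inv_qParam_pow]
  rw [Finset.prod_insert (by decide), Finset.prod_insert (by decide), Finset.prod_insert (by decide),
    Finset.prod_insert (by decide), Finset.prod_insert (by decide), Finset.prod_insert (by decide),
    Finset.prod_insert (by decide), Finset.prod_insert (by decide), Finset.prod_singleton]
  rw [show expFn [(6, -2), (12, 4), (18, 2), (36, -4)] 1 = 0 by decide,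
    show expFn [(6, -2), (12, 4), (18, 2), (36, -4)] 2 = 0 by decide,
    show expFn [(6, -2), (12, 4), (18, 2), (36, -4)] 3 = 0 by decide,
    show expFn [(6, -2), (12, 4), (18, 2), (36, -4)] 4 = 0 by decide,
    show expFn [(6, -2), (12, 4), (18, 2), (36, -4)] 6 = -2 by decide,
    show expFn [(6, -2), (12, 4), (18, 2), (36, -4)] 9 = 0 by decide,
    show expFn [(6, -2), (12, 4), (18, 2), (36, -4)] 12 = 4 by decide,
    show expFn [(6, -2), (12, 4), (18, 2), (36, -4)] 18 = 2 by decide,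
    show expFn [(6, -2), (12, 4), (18, 2), (36, -4)] 36 = -4 by decide]
  simp only [zpow_neg, zpow_ofNat]
  field_simp

/-- **`φ₃₆ = η(6τ)⁴ = q E₆⁴`.** [folklore] -/
theorem etaProductThirtySix_eq (τ : ℍ) :
    cuspFormEtaProductThirtySix τ = Function.Periodic.qParam 1 (τ : ℂ) * eulerFn 6 τ ^ 4 := by
  rw [show (cuspFormEtaProductThirtySix τ : ℂ) = etaProductThirtySix τ from rfl, etaProductThirtySix_apply]
  have h6 := eta_natMul_eq_qParam_mul_eulerFn 6 τ
  push_cast at h6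
  rw [h6]
  have hq : Function.Periodic.qParam 24 (6 * (τ : ℂ)) ^ 4 = Function.Periodic.qParam 1 (τ : ℂ) := by
    simp only [Function.Periodic.qParam, ← Complex.exp_nat_mul]
    congr 1
    push_cast
    ring
  rw [← hq]
  ring

/-! ## §2 The logarithmic derivatives of `x` and `Y` -/

/-- **`x′ = x · (E₁₂′/E₁₂ + 3E₁₈′/E₁₈ − 2·2πi − E₆′/E₆ − 3E₃₆′/E₃₆)`.** [folklore] -/
theorem deriv_x36 (τ : ℍ) :
    deriv (etaQuotient 36 (expFn [(6, -1), (12, 1), (18, 3), (36, -3)]) ∘ ofComplex) τ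
      = eulerFn 12 τ * eulerFn 18 τ ^ 3
          / (Function.Periodic.qParam 1 (τ : ℂ) ^ 2 * eulerFn 6 τ * eulerFn 36 τ ^ 3)
        * (deriv (eulerFn 12 ∘ ofComplex) τ / eulerFn 12 τ
          + 3 * deriv (eulerFn 18 ∘ ofComplex) τ / eulerFn 18 τ - 2 * (2 * π * I)
          - deriv (eulerFn 6 ∘ ofComplex) τ / eulerFn 6 τ
          - 3 * deriv (eulerFn 36 ∘ ofComplex) τ / eulerFn 36 τ) := by
  have hE6 := eulerFn_ne_zero (by norm_num : 0 < 6) τ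
  have hE12 := eulerFn_ne_zero (by norm_num : 0 < 12) τ
  have hE18 := eulerFn_ne_zero (by norm_num : 0 < 18) τ
  have hE36 := eulerFn_ne_zero (by norm_num : 0 < 36) τ
  have hq := qParam_ne_zero τ
  have hfun : (etaQuotient 36 (expFn [(6, -1), (12, 1), (18, 3), (36, -3)]) ∘ ofComplex) =ᶠ[𝓝 (τ : ℂ)]
      fun z ↦ (eulerFn 12 ∘ ofComplex) z * (eulerFn 18 ∘ ofComplex) z ^ 3
        / (Function.Periodic.qParam 1 z ^ 2 * (eulerFn 6 ∘ ofComplex) z * (eulerFn 36 ∘ ofComplex) z ^ 3) := by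
    filter_upwards [isOpen_upperHalfPlaneSet.mem_nhds τ.im_pos] with z hz
    simp only [Function.comp_apply, x36_eq, ofComplex_apply_of_im_pos hz]
  rw [hfun.deriv_eq]
  have h6 := hasDerivAt_eulerFn_comp 6 τ
  have h12 := hasDerivAt_eulerFn_comp 12 τ
  have h18 := hasDerivAt_eulerFn_comp 18 τ
  have h36 := hasDerivAt_eulerFn_comp 36 τ
  have hqd : HasDerivAt (Function.Periodic.qParam 1) (2 * π * I * Function.Periodic.qParam 1 (τ : ℂ)) τ := by
    simpa using hasDerivAt_qParam 1 (τ : ℂ)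
  have hden : Function.Periodic.qParam 1 (τ : ℂ) ^ 2 * (eulerFn 6 ∘ ofComplex) τ
      * (eulerFn 36 ∘ ofComplex) τ ^ 3 ≠ 0 := by
    simp only [Function.comp_apply, ofComplex_apply]
    exact mul_ne_zero (mul_ne_zero (pow_ne_zero _ hq) hE6) (pow_ne_zero _ hE36)
  have hD := (h12.fun_mul (h18.fun_pow 3)).fun_div
    (((hqd.fun_pow 2).fun_mul h6).fun_mul (h36.fun_pow 3)) hden
  rw [hD.deriv]
  simp only [Function.comp_apply, ofComplex_apply]
  field_simp
  ring

/-- **`Y′ = Y · (4E₁₂′/E₁₂ + 2E₁₈′/E₁₈ − 3·2πi − 2E₆′/E₆ − 4E₃₆′/E₃₆)`.** [folklore] -/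
theorem deriv_Y36 (τ : ℍ) :
    deriv (etaQuotient 36 (expFn [(6, -2), (12, 4), (18, 2), (36, -4)]) ∘ ofComplex) τ
      = eulerFn 12 τ ^ 4 * eulerFn 18 τ ^ 2
          / (Function.Periodic.qParam 1 (τ : ℂ) ^ 3 * eulerFn 6 τ ^ 2 * eulerFn 36 τ ^ 4)
        * (4 * deriv (eulerFn 12 ∘ ofComplex) τ / eulerFn 12 τ
          + 2 * deriv (eulerFn 18 ∘ ofComplex) τ / eulerFn 18 τ - 3 * (2 * π * I)
          - 2 * deriv (eulerFn 6 ∘ ofComplex) τ / eulerFn 6 τ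
          - 4 * deriv (eulerFn 36 ∘ ofComplex) τ / eulerFn 36 τ) := by
  have hE6 := eulerFn_ne_zero (by norm_num : 0 < 6) τ
  have hE12 := eulerFn_ne_zero (by norm_num : 0 < 12) τ
  have hE18 := eulerFn_ne_zero (by norm_num : 0 < 18) τ
  have hE36 := eulerFn_ne_zero (by norm_num : 0 < 36) τ
  have hq := qParam_ne_zero τ
  have hfun : (etaQuotient 36 (expFn [(6, -2), (12, 4), (18, 2), (36, -4)]) ∘ ofComplex) =ᶠ[𝓝 (τ : ℂ)]
      fun z ↦ (eulerFn 12 ∘ ofComplex) z ^ 4 * (eulerFn 18 ∘ ofComplex) z ^ 2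
        / (Function.Periodic.qParam 1 z ^ 3 * (eulerFn 6 ∘ ofComplex) z ^ 2
          * (eulerFn 36 ∘ ofComplex) z ^ 4) := by
    filter_upwards [isOpen_upperHalfPlaneSet.mem_nhds τ.im_pos] with z hz
    simp only [Function.comp_apply, Y36_eq, ofComplex_apply_of_im_pos hz]
  rw [hfun.deriv_eq]
  have h6 := hasDerivAt_eulerFn_comp 6 τ
  have h12 := hasDerivAt_eulerFn_comp 12 τ
  have h18 := hasDerivAt_eulerFn_comp 18 τ
  have h36 := hasDerivAt_eulerFn_comp 36 τ
  have hqd : HasDerivAt (Function.Periodic.qParam 1) (2 * π * I * Function.Periodic.qParam 1 (τ : ℂ)) τ := by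
    simpa using hasDerivAt_qParam 1 (τ : ℂ)
  have hden : Function.Periodic.qParam 1 (τ : ℂ) ^ 3 * (eulerFn 6 ∘ ofComplex) τ ^ 2
      * (eulerFn 36 ∘ ofComplex) τ ^ 4 ≠ 0 := by
    simp only [Function.comp_apply, ofComplex_apply]
    exact mul_ne_zero (mul_ne_zero (pow_ne_zero _ hq) (pow_ne_zero _ hE6)) (pow_ne_zero _ hE36)
  have hD := ((h12.fun_pow 4).fun_mul (h18.fun_pow 2)).fun_div
    (((hqd.fun_pow 3).fun_mul (h6.fun_pow 2)).fun_mul (h36.fun_pow 4)) hden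
  rw [hD.deriv]
  simp only [Function.comp_apply, ofComplex_apply]
  field_simp
  ring

/-! ## §3 The `q`-asymptotics (T1), (T2), (T3) at `i∞` -/

/-- **(T1)₃₆**: `((2πi)⁻¹x′ + φ₃₆·2Y)/q → 0` at `i∞` (window `q⁻² … q¹`: all `E_δ ≡ 1`, `E_δ′ ≡ 0`). [folklore] -/
theorem tendsto_T1 :
    Tendsto (fun τ : ℍ ↦ ((2 * π * I)⁻¹
      * deriv (etaQuotient 36 (expFn [(6, -1), (12, 1), (18, 3), (36, -3)]) ∘ ofComplex) τ
      + cuspFormEtaProductThirtySix τ * (2 * etaQuotient 36 (expFn [(6, -2), (12, 4), (18, 2), (36, -4)]) τ))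
      / Function.Periodic.qParam 1 (τ : ℂ)) atImInfty (𝓝 0) := by
  have h2pi : (2 * π * I : ℂ) ≠ 0 := by simp [Real.pi_ne_zero, I_ne_zero]
  have hE6 := tendsto_eulerFn (δ := 6) (m := 3) (by norm_num)
  have hE12 := tendsto_eulerFn (δ := 12) (m := 3) (by norm_num)
  have hE18 := tendsto_eulerFn (δ := 18) (m := 3) (by norm_num)
  have hE36 := tendsto_eulerFn (δ := 36) (m := 3) (by norm_num)
  -- `T_δ = (2πi)⁻¹ E_δ′ = o(q³)`
  have hT6 := QRemainder.congr_poly (P' := 0) (by rw [mul_zero])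
    (QRemainder.const_mul (2 * π * I)⁻¹ (tendsto_deriv_eulerFn (δ := 6) (m := 3) (by norm_num)))
  have hT12 := QRemainder.congr_poly (P' := 0) (by rw [mul_zero])
    (QRemainder.const_mul (2 * π * I)⁻¹ (tendsto_deriv_eulerFn (δ := 12) (m := 3) (by norm_num)))
  have hT18 := QRemainder.congr_poly (P' := 0) (by rw [mul_zero])
    (QRemainder.const_mul (2 * π * I)⁻¹ (tendsto_deriv_eulerFn (δ := 18) (m := 3) (by norm_num)))
  have hT36 := QRemainder.congr_poly (P' := 0) (by rw [mul_zero])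
    (QRemainder.const_mul (2 * π * I)⁻¹ (tendsto_deriv_eulerFn (δ := 36) (m := 3) (by norm_num)))
  -- `G₁ = E₁₈²(T₁₂E₆E₁₈E₃₆ + 3T₁₈E₁₂E₆E₃₆ − 2E₁₂E₁₈E₆E₃₆ − T₆E₁₂E₁₈E₃₆ − 3T₃₆E₁₂E₁₈E₆) + 2E₆⁴E₁₂⁴E₁₈² = o(q³)`
  have hA := QRemainder.mul (QRemainder.mul (QRemainder.mul hT12 hE6) hE18) hE36
  have hB := QRemainder.mul (QRemainder.mul (QRemainder.mul (QRemainder.const_mul 3 hT18) hE12) hE6) hE36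
  have hC := QRemainder.mul (QRemainder.mul (QRemainder.mul (QRemainder.const_mul 2 hE12) hE18) hE6) hE36
  have hD := QRemainder.mul (QRemainder.mul (QRemainder.mul hT6 hE12) hE18) hE36
  have hE := QRemainder.mul (QRemainder.mul (QRemainder.mul (QRemainder.const_mul 3 hT36) hE12) hE18) hE6
  have h1 := QRemainder.mul (QRemainder.pow hE18 2)
    (QRemainder.sub (QRemainder.sub (QRemainder.sub (QRemainder.add hA hB) hC) hD) hE)
  have h2 := QRemainder.mul (QRemainder.mul (QRemainder.const_mul 2 (QRemainder.pow hE6 4))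
    (QRemainder.pow hE12 4)) (QRemainder.pow hE18 2)
  have hG := QRemainder.reduce 0 0 (by simp only [map_ofNat]; ring) (QRemainder.add h1 h2)
  have hlim := (QRemainder.tendsto_div_pow 3 le_rfl hG).mul
    ((((isIntUnitQExp_eulerFn (by norm_num : 0 < 6)).tendsto_one.pow 2).mul
      ((isIntUnitQExp_eulerFn (by norm_num : 0 < 36)).tendsto_one.pow 4)).inv₀ (by norm_num))
  rw [zero_mul] at hlim
  refine hlim.congr fun τ ↦ ?_
  have hE6' := eulerFn_ne_zero (by norm_num : 0 < 6) τ
  have hE12' := eulerFn_ne_zero (by norm_num : 0 < 12) τ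
  have hE18' := eulerFn_ne_zero (by norm_num : 0 < 18) τ
  have hE36' := eulerFn_ne_zero (by norm_num : 0 < 36) τ
  have hq := qParam_ne_zero τ
  rw [deriv_x36, Y36_eq, etaProductThirtySix_eq]
  field_simp

/-- **(T2)₃₆**: `((2πi)⁻¹Y′ + φ₃₆·3x²)/q → 0` at `i∞` (window `q⁻³ … q¹`: all `E_δ ≡ 1`, `E_δ′ ≡ 0`). [folklore] -/
theorem tendsto_T2 :
    Tendsto (fun τ : ℍ ↦ ((2 * π * I)⁻¹
      * deriv (etaQuotient 36 (expFn [(6, -2), (12, 4), (18, 2), (36, -4)]) ∘ ofComplex) τ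
      + cuspFormEtaProductThirtySix τ
        * (3 * etaQuotient 36 (expFn [(6, -1), (12, 1), (18, 3), (36, -3)]) τ ^ 2))
      / Function.Periodic.qParam 1 (τ : ℂ)) atImInfty (𝓝 0) := by
  have h2pi : (2 * π * I : ℂ) ≠ 0 := by simp [Real.pi_ne_zero, I_ne_zero]
  have hE6 := tendsto_eulerFn (δ := 6) (m := 4) (by norm_num)
  have hE12 := tendsto_eulerFn (δ := 12) (m := 4) (by norm_num)
  have hE18 := tendsto_eulerFn (δ := 18) (m := 4) (by norm_num)
  have hE36 := tendsto_eulerFn (δ := 36) (m := 4) (by norm_num)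
  have hT6 := QRemainder.congr_poly (P' := 0) (by rw [mul_zero])
    (QRemainder.const_mul (2 * π * I)⁻¹ (tendsto_deriv_eulerFn (δ := 6) (m := 4) (by norm_num)))
  have hT12 := QRemainder.congr_poly (P' := 0) (by rw [mul_zero])
    (QRemainder.const_mul (2 * π * I)⁻¹ (tendsto_deriv_eulerFn (δ := 12) (m := 4) (by norm_num)))
  have hT18 := QRemainder.congr_poly (P' := 0) (by rw [mul_zero])
    (QRemainder.const_mul (2 * π * I)⁻¹ (tendsto_deriv_eulerFn (δ := 18) (m := 4) (by norm_num)))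
  have hT36 := QRemainder.congr_poly (P' := 0) (by rw [mul_zero])
    (QRemainder.const_mul (2 * π * I)⁻¹ (tendsto_deriv_eulerFn (δ := 36) (m := 4) (by norm_num)))
  -- `G₂ = E₁₂³E₁₈E₃₆(4T₁₂E₁₈E₆E₃₆ + 2T₁₈E₁₂E₆E₃₆ − 3E₁₂E₁₈E₆E₃₆ − 2T₆E₁₂E₁₈E₃₆ − 4T₃₆E₁₂E₁₈E₆) + 3E₆⁵E₁₂²E₁₈⁶`
  have hA := QRemainder.mul (QRemainder.mul (QRemainder.mul (QRemainder.const_mul 4 hT12) hE18) hE6) hE36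
  have hB := QRemainder.mul (QRemainder.mul (QRemainder.mul (QRemainder.const_mul 2 hT18) hE12) hE6) hE36
  have hC := QRemainder.mul (QRemainder.mul (QRemainder.mul (QRemainder.const_mul 3 hE12) hE18) hE6) hE36
  have hD := QRemainder.mul (QRemainder.mul (QRemainder.mul (QRemainder.const_mul 2 hT6) hE12) hE18) hE36
  have hE := QRemainder.mul (QRemainder.mul (QRemainder.mul (QRemainder.const_mul 4 hT36) hE12) hE18) hE6
  have h1 := QRemainder.mul (QRemainder.mul (QRemainder.mul (QRemainder.pow hE12 3) hE18) hE36)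
    (QRemainder.sub (QRemainder.sub (QRemainder.sub (QRemainder.add hA hB) hC) hD) hE)
  have h2 := QRemainder.mul (QRemainder.mul (QRemainder.const_mul 3 (QRemainder.pow hE6 5))
    (QRemainder.pow hE12 2)) (QRemainder.pow hE18 6)
  have hG := QRemainder.reduce 0 0 (by simp only [map_ofNat]; ring) (QRemainder.add h1 h2)
  have hlim := (QRemainder.tendsto_div_pow 4 le_rfl hG).mul
    ((((isIntUnitQExp_eulerFn (by norm_num : 0 < 6)).tendsto_one.pow 3).mul
      ((isIntUnitQExp_eulerFn (by norm_num : 0 < 36)).tendsto_one.pow 6)).inv₀ (by norm_num))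
  rw [zero_mul] at hlim
  refine hlim.congr fun τ ↦ ?_
  have hE6' := eulerFn_ne_zero (by norm_num : 0 < 6) τ
  have hE12' := eulerFn_ne_zero (by norm_num : 0 < 12) τ
  have hE18' := eulerFn_ne_zero (by norm_num : 0 < 18) τ
  have hE36' := eulerFn_ne_zero (by norm_num : 0 < 36) τ
  have hq := qParam_ne_zero τ
  rw [deriv_Y36, x36_eq, etaProductThirtySix_eq]
  field_simp

/-- **(T3)₃₆**: `x³ + 1 − Y² → 0` at `i∞` (window `q⁻⁶ … q⁰`: `E₆ ≡ 1 − q⁶`, `E₁₂ ≡ E₁₈ ≡ E₃₆ ≡ 1`). [folklore] -/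
theorem tendsto_T3 :
    Tendsto (fun τ : ℍ ↦ etaQuotient 36 (expFn [(6, -1), (12, 1), (18, 3), (36, -3)]) τ ^ 3 + 1
      - etaQuotient 36 (expFn [(6, -2), (12, 4), (18, 2), (36, -4)]) τ ^ 2) atImInfty (𝓝 0) := by
  have hE6 := tendsto_eulerFn_six
  have hE12 := tendsto_eulerFn (δ := 12) (m := 6) (by norm_num)
  have hE18 := tendsto_eulerFn (δ := 18) (m := 6) (by norm_num)
  have hE36 := tendsto_eulerFn (δ := 36) (m := 6) (by norm_num)
  -- `G₃ = E₆E₁₂³E₁₈⁹ + q⁶E₆⁴E₃₆⁹ − E₁₂⁸E₁₈⁴E₃₆ = o(q⁶)`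
  have h1 := QRemainder.mul (QRemainder.mul hE6 (QRemainder.pow hE12 3)) (QRemainder.pow hE18 9)
  have h2 := QRemainder.qParam_pow_mul 6 (QRemainder.mul (QRemainder.pow hE6 4) (QRemainder.pow hE36 9))
  have h3 := QRemainder.mul (QRemainder.mul (QRemainder.pow hE12 8) (QRemainder.pow hE18 4)) hE36
  have hG := QRemainder.reduce 0 (-4 * X ^ 5 + 6 * X ^ 11 - 4 * X ^ 17 + X ^ 23) (by ring)
    (QRemainder.sub (QRemainder.add h1 h2) h3)
  have hlim := (QRemainder.tendsto_div_pow 6 le_rfl hG).mul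
    ((((isIntUnitQExp_eulerFn (by norm_num : 0 < 6)).tendsto_one.pow 4).mul
      ((isIntUnitQExp_eulerFn (by norm_num : 0 < 36)).tendsto_one.pow 9)).inv₀ (by norm_num))
  rw [zero_mul] at hlim
  refine hlim.congr fun τ ↦ ?_
  have hE6' := eulerFn_ne_zero (by norm_num : 0 < 6) τ
  have hE12' := eulerFn_ne_zero (by norm_num : 0 < 12) τ
  have hE18' := eulerFn_ne_zero (by norm_num : 0 < 18) τ
  have hE36' := eulerFn_ne_zero (by norm_num : 0 < 36) τ
  have hq := qParam_ne_zero τ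
  rw [x36_eq, Y36_eq]
  field_simp

/-! ## §4 The identities, (S2)₃₆, and `|c| = 1` on `X₀(36)` — unconditionally -/

/-- **(I2a)**: `x′ = −2πi φ₃₆ · 2Y` on `ℍ`. [cite: Ligozat1975, Ch. 4] -/
theorem ligozat36_deriv_x (τ : ℍ) :
    deriv (etaQuotient 36 (expFn [(6, -1), (12, 1), (18, 3), (36, -3)]) ∘ ofComplex) τ
      = -(2 * π * I * cuspFormEtaProductThirtySix τ)
          * (2 * etaQuotient 36 (expFn [(6, -2), (12, 4), (18, 2), (36, -4)]) τ) :=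
  EtaIdentityReductionThirtySix.deriv_x36_of_tendsto tendsto_T1 τ

/-- **(I2b)**: `Y′ = −2πi φ₃₆ · 3x²` on `ℍ`. [cite: Ligozat1975, Ch. 4] -/
theorem ligozat36_deriv_Y (τ : ℍ) :
    deriv (etaQuotient 36 (expFn [(6, -2), (12, 4), (18, 2), (36, -4)]) ∘ ofComplex) τ
      = -(2 * π * I * cuspFormEtaProductThirtySix τ)
          * (3 * etaQuotient 36 (expFn [(6, -1), (12, 1), (18, 3), (36, -3)]) τ ^ 2) :=
  EtaIdentityReductionThirtySix.deriv_Y36_of_tendsto tendsto_T2 τ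

/-- **(I1): the cubic `x³ + 1 = Y²` on `ℍ`** — the `η`-quotients `x = η₁₂η₁₈³/(η₆η₃₆³)`,
`Y = η₁₂⁴η₁₈²/(η₆²η₃₆⁴)` parametrise the affine curve `Y² = X³ + 1` (the optimal curve `36a1 = X₀(36)`). [cite: Ligozat1975, Ch. 4] -/
theorem ligozat36_cubic (τ : ℍ) :
    etaQuotient 36 (expFn [(6, -1), (12, 1), (18, 3), (36, -3)]) τ ^ 3 + 1
      = etaQuotient 36 (expFn [(6, -2), (12, 4), (18, 2), (36, -4)]) τ ^ 2 :=
  EtaIdentityReductionThirtySix.cubic36_of_deriv ligozat36_deriv_x ligozat36_deriv_Y tendsto_T3 τ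

/-- **(S2)₃₆ unconditionally**: the period lattice of `φ₃₆ = η(6τ)⁴` lies in the lattice of the Weierstrass
pair with invariants `g₂ = 0`, `g₃ = −4` (the Néron invariants of `36a1 : y² = x³ + 1`). [cite: CremonaAlgorithms1997, §2.10] -/
theorem periodLatticeLeHex_thirtySix :
    ∃ L₁ : PeriodPair, L₁.g₂ = 0 ∧ L₁.g₃ = -4 ∧
      ∀ z ∈ periodLattice cuspFormEtaProductThirtySix, z ∈ L₁.lattice :=
  EtaIdentityReductionThirtySix.periodLatticeLeHex36_of_tendsto tendsto_T1 tendsto_T2 tendsto_T3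

/-- **`|c| = 1` on `X₀(36)`, unconditionally**: for every globally minimal `W/ℚ` and every
`X₀(36)`-parametrisation datum `D` of `W` with the lattice clause `Λ_W = c·Λ_f`, the Manin constant satisfies
`|c| = 1` — no modularity, CDT or printed Manin-constant fact is assumed.  `N = 36 = 4·9` is the first level
in the domains of BOTH cruxes C2 (`4 ∣ N`) and C3 (`9 ∣ N`). [cite: CremonaAlgorithms1997, Table 1 (36a1)] -/
theorem abs_maninConstant_eq_one_thirtySix (W : WeierstrassCurve ℚ) [W.IsGloballyMinimal]
    (D : ModularParametrizationData W 36)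
    (hopt : ∀ z ∈ D.L.lattice, ∃ w ∈ periodLattice D.f, z = D.c * w) :
    |D.maninConstant| = 1 :=
  EtaIdentityReductionThirtySix.abs_maninConstant_eq_one_thirtySix_of_tendsto tendsto_T1 tendsto_T2
    tendsto_T3 W D hopt

/-- **`2 ∤ c` on `X₀(36)`, unconditionally** — the shape of the crux C2 `ManinOddAtFour` at the level
`N = 36` (`2² ∣ 36`), with none of its four fact hypotheses. [cite: CremonaAlgorithms1997, Table 1 (36a1)] -/
theorem not_two_dvd_maninConstant_thirtySix (W : WeierstrassCurve ℚ) [W.IsGloballyMinimal]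
    (D : ModularParametrizationData W 36)
    (hopt : ∀ z ∈ D.L.lattice, ∃ w ∈ periodLattice D.f, z = D.c * w) :
    ¬ (2 : ℤ) ∣ D.maninConstant := by
  intro h
  have h1 := abs_maninConstant_eq_one_thirtySix W D hopt
  obtain ⟨k, hk⟩ := h
  rw [hk, abs_mul] at h1
  have : (2 : ℤ) ∣ 1 := ⟨|k|, by rw [← h1]; simp⟩
  omega

/-- **`3 ∤ c` on `X₀(36)`, unconditionally** — the shape of the crux C3 `ManinPrimeToThreeAtNine` at the
level `N = 36` (`3² ∣ 36`), with none of its four fact hypotheses. [cite: CremonaAlgorithms1997, Table 1 (36a1)] -/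
theorem not_three_dvd_maninConstant_thirtySix (W : WeierstrassCurve ℚ) [W.IsGloballyMinimal]
    (D : ModularParametrizationData W 36)
    (hopt : ∀ z ∈ D.L.lattice, ∃ w ∈ periodLattice D.f, z = D.c * w) :
    ¬ (3 : ℤ) ∣ D.maninConstant := by
  intro h
  have h1 := abs_maninConstant_eq_one_thirtySix W D hopt
  obtain ⟨k, hk⟩ := h
  rw [hk, abs_mul] at h1
  have : (3 : ℤ) ∣ 1 := ⟨|k|, by rw [← h1]; simp⟩
  omega

end Summit.BirchSwinnertonDyer.BirchSwinnertonDyer.Theorems.ManinLocalTwoThree.LigozatIdentitiesThirtySix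

end
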